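import Literature.NumberTheory.Sieve.GoldstonPintzYildirimTheta
import Literature.NumberTheory.Sieve.GoldstonPintzYildirimEulerProduct
import HarnessLib

/-!
# Goldston–Pintz–Yıldırım, *Primes in tuples I*, §9 (9.16)–(9.23): the Euler factors of the
# twisted series and `G(0,0) = 𝔖(H⁰)`

Trunk: NumberTheory / Sieve. Continuation of `GoldstonPintzYildirimTheta` (the twisted counts
`ν*_p`, `ν̄*_p` of (9.9)–(9.11)) towards the main term of GPY **Proposition 2**
(D. A. Goldston, J. Pintz, C. Y. Yıldırım, *Primes in tuples. I*, Ann. of Math. 170 (2009) =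
arXiv:math/0508185, §9, pp. 19–20): the local factors of the double series (9.16),

  `F(s₁, s₂) = ∏_p (1 − ν*_p(H₁⁰)/((p−1)p^{s₁}) − ν*_p(H₂⁰)/((p−1)p^{s₂}) + ν̄*_p((H₁∩̄H₂)⁰)/((p−1)p^{s₁+s₂}))`,

the factors of `G(s₁, s₂) = F(s₁,s₂) ζ(1+s₁)^a ζ(1+s₂)^b ζ(1+s₁+s₂)^{−d}` in the three cases
(9.17)–(9.19), and the value **`G(0, 0) = 𝔖(H⁰)`** ((9.20)–(9.23)). Everything here is PROVED.

* `Literature.NumberTheory.Sieve.GPY.starFactor h₀ H₁ H₂ p s₁ s₂` — the Euler factor of (9.16);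
* `Literature.NumberTheory.Sieve.GPY.caseA h₀ H₁ = #(H₁ ∖ {h₀})`, `caseB h₀ H₂ = #(H₂ ∖ {h₀})`,
  `caseD h₀ H₁ H₂ = #((H₁ ∩ H₂) ∖ {h₀})` — the exponents `(a, b, d)` of (9.17)–(9.19) written
  uniformly (`caseA_of_not_mem` … `caseD_of_mem_inter`: `(k₁, k₂, r)` if `h₀ ∉ H`,
  `(k₁−1, k₂, r)` if `h₀ ∈ H₁ ∖ H₂`, `(k₁−1, k₂−1, r−1)` if `h₀ ∈ H₁ ∩ H₂`; the uniform form also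
  covers the relabelled case `h₀ ∈ H₂ ∖ H₁` of the Remark after Proposition 2);
* `nuStarPrime_eq_caseA`, `nuBarStar_eq_caseD` — for `p` exceeding every element of
  `H⁰ = H₁ ∪ H₂ ∪ {h₀}`: `ν*_p(H₁⁰) = a`, `ν*_p(H₂⁰) = b`, `ν̄*_p = d` ("for `p > h`", Cases 1–3),
  whence `starFactor_eq_of_lt`;
* `Literature.NumberTheory.Sieve.GPY.starGFactor h₀ H₁ H₂ a b d p s₁ s₂` — the Euler factor of `G` and
  `Literature.NumberTheory.Sieve.GPY.GStar … a b d s₁ s₂ = ∏'_p starGFactor` ((9.17)–(9.19));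
* `starFactor_zero_zero` — `starFactor(0,0) = (p − ν_p(H⁰))/(p − 1)` ((9.21), by
  `ν*_p(H₁⁰) + ν*_p(H₂⁰) − ν̄*_p = ν_p(H⁰) − 1`, `nuBarStar_eq`);
* `caseA_add_caseB_sub_caseD` — `a + b − d = #H⁰ − 1` in all cases;
* `starGFactor_zero_zero` — `starGFactor(0,0) = (1 − ν_p(H⁰)/p)(1 − 1/p)^{−#H⁰}`, the
  Hardy–Littlewood factor of `H⁰` ((9.22)–(9.23) locally), and **`GStar_zero_zero`**:
  `G(0,0) = 𝔖(H⁰)` ((9.20)).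

What is NOT here: the convergence of the product for `σ₁, σ₂ > −1/4`, the bound (8.3) and the
identification of `F` with the double Dirichlet series of `𝒯̃_R` ((9.15)–(9.16) analytically) —
the next steps of the source.

## References

* D. A. Goldston, J. Pintz, C. Y. Yıldırım, *Primes in tuples. I*, Ann. of Math. (2) 170 (2009),
  819–862 = arXiv:math/0508185, §9, (9.16)–(9.23), pp. 19–20. [cite: GoldstonPintzYildirim2009]
-/

noncomputable section

open Finset
open scoped ArithmeticFunction.Moebius ArithmeticFunction.omega

namespace Literature.NumberTheory.Sieve.GPY

/-! ### The exponents `(a, b, d)` of (9.17)–(9.19) -/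

/-- `a = #(H₁ ∖ {h₀})`: the exponent of `ζ(1+s₁)^{−1}` in (9.17)–(9.19) (`k₁` if `h₀ ∉ H₁`,
`k₁ − 1` if `h₀ ∈ H₁`). [cite: GoldstonPintzYildirim2009, Section 9 eq. 9.17] -/
def caseA (h₀ : ℕ) (H₁ : Finset ℕ) : ℕ := #(H₁.erase h₀)

/-- `d = #((H₁ ∩ H₂) ∖ {h₀})`: the exponent of `ζ(1+s₁+s₂)` in (9.17)–(9.19) (`r` unless
`h₀ ∈ H₁ ∩ H₂`, then `r − 1`). [cite: GoldstonPintzYildirim2009, Section 9 eq. 9.19] -/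
def caseD (h₀ : ℕ) (H₁ H₂ : Finset ℕ) : ℕ := #((H₁ ∩ H₂).erase h₀)

/-- Case 1 (`h₀ ∉ H₁`): `a = k₁` (and symmetrically `b = k₂` with `caseA h₀ H₂`).
[cite: GoldstonPintzYildirim2009, Section 9 eq. 9.17] -/
theorem caseA_of_not_mem {h₀ : ℕ} {H₁ : Finset ℕ} (h : h₀ ∉ H₁) : caseA h₀ H₁ = #H₁ := by
  rw [caseA, Finset.erase_eq_of_notMem h]

/-- Cases 2–3 (`h₀ ∈ H₁`): `a = k₁ − 1`. [cite: GoldstonPintzYildirim2009, Section 9 eq. 9.18] -/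
theorem caseA_of_mem {h₀ : ℕ} {H₁ : Finset ℕ} (h : h₀ ∈ H₁) : caseA h₀ H₁ = #H₁ - 1 := by
  rw [caseA, Finset.card_erase_of_mem h]

/-- Cases 1–2 (`h₀ ∉ H₁ ∩ H₂`): `d = r`. [cite: GoldstonPintzYildirim2009, Section 9 eq. 9.17] -/
theorem caseD_of_not_mem {h₀ : ℕ} {H₁ H₂ : Finset ℕ} (h : h₀ ∉ H₁ ∩ H₂) :
    caseD h₀ H₁ H₂ = #(H₁ ∩ H₂) := by
  rw [caseD, Finset.erase_eq_of_notMem h]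

/-- Case 3 (`h₀ ∈ H₁ ∩ H₂`): `d = r − 1`. [cite: GoldstonPintzYildirim2009, Section 9 eq. 9.19] -/
theorem caseD_of_mem {h₀ : ℕ} {H₁ H₂ : Finset ℕ} (h : h₀ ∈ H₁ ∩ H₂) :
    caseD h₀ H₁ H₂ = #(H₁ ∩ H₂) - 1 := by
  rw [caseD, Finset.card_erase_of_mem h]

/-- `d ≤ a`. [cite: GoldstonPintzYildirim2009, Section 8 eq. 8.4] -/
theorem caseD_le_caseA (h₀ : ℕ) (H₁ H₂ : Finset ℕ) : caseD h₀ H₁ H₂ ≤ caseA h₀ H₁ :=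
  Finset.card_le_card (Finset.erase_subset_erase _ Finset.inter_subset_left)

/-- `d ≤ b`. [cite: GoldstonPintzYildirim2009, Section 8 eq. 8.4] -/
theorem caseD_le_caseB (h₀ : ℕ) (H₁ H₂ : Finset ℕ) : caseD h₀ H₁ H₂ ≤ caseA h₀ H₂ :=
  Finset.card_le_card (Finset.erase_subset_erase _ Finset.inter_subset_right)

/-- `a + b − d = #H⁰ − 1`, `H⁰ = H₁ ∪ H₂ ∪ {h₀}`: the exponent bookkeeping of (9.21)
(`k − r`, `k − r − 1`, `k − r − 1` in Cases 1, 2, 3), stated additively.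
[cite: GoldstonPintzYildirim2009, Section 9 eq. 9.21] -/
theorem caseA_add_caseB_sub_caseD (h₀ : ℕ) (H₁ H₂ : Finset ℕ) :
    caseA h₀ H₁ + caseA h₀ H₂ + 1 = #(insert h₀ (H₁ ∪ H₂)) + caseD h₀ H₁ H₂ := by
  unfold caseA caseD
  have hU : H₁.erase h₀ ∪ H₂.erase h₀ = (H₁ ∪ H₂).erase h₀ := by
    ext x; simp only [Finset.mem_union, Finset.mem_erase]; tauto
  have hI : H₁.erase h₀ ∩ H₂.erase h₀ = (H₁ ∩ H₂).erase h₀ := by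
    ext x; simp only [Finset.mem_inter, Finset.mem_erase]; tauto
  have hins : insert h₀ (H₁ ∪ H₂) = insert h₀ ((H₁ ∪ H₂).erase h₀) := by
    ext x; simp only [Finset.mem_insert, Finset.mem_erase]; tauto
  have hcard : #(insert h₀ (H₁ ∪ H₂)) = #((H₁ ∪ H₂).erase h₀) + 1 := by
    rw [hins, Finset.card_insert_of_notMem (Finset.notMem_erase h₀ _)]
  have hie := Finset.card_union_add_card_inter (H₁.erase h₀) (H₂.erase h₀)
  rw [hU, hI] at hie
  omega

/-- "For all `p > h`": if every element of `G ∪ {h₀}` is `< p`, then `ν*_p(G⁰) = #(G ∖ {h₀})`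
(Cases 1–3 of §9: `k₁` or `k₁ − 1`). [cite: GoldstonPintzYildirim2009, Section 9 eq. 9.17] -/
theorem nuStarPrime_eq_caseA {h₀ p : ℕ} {G : Finset ℕ} (hh₀ : h₀ < p) (hG : ∀ x ∈ G, x < p) :
    nuStarPrime h₀ G p = caseA h₀ G := by
  have hall : ∀ x ∈ insert h₀ G, x < p := by
    intro x hx
    rcases Finset.mem_insert.1 hx with rfl | hx
    · exact hh₀
    · exact hG x hx
  rw [nuStarPrime, nuPrime_eq_card hall, caseA]
  have hins : insert h₀ G = insert h₀ (G.erase h₀) := by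
    ext x; simp only [Finset.mem_insert, Finset.mem_erase]; tauto
  rw [hins, Finset.card_insert_of_notMem (Finset.notMem_erase h₀ _)]
  omega

/-- "For all `p > h`": if every element of `H₁ ∪ H₂ ∪ {h₀}` is `< p`, then
`ν̄*_p((H₁ ∩̄ H₂)⁰) = #((H₁ ∩ H₂) ∖ {h₀})` (`r` or `r − 1`).
[cite: GoldstonPintzYildirim2009, Section 9 eq. 9.19] -/
theorem nuBarStar_eq_caseD {h₀ p : ℕ} {H₁ H₂ : Finset ℕ} (hh₀ : h₀ < p) (hH₁ : ∀ x ∈ H₁, x < p)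
    (hH₂ : ∀ x ∈ H₂, x < p) : nuBarStar h₀ H₁ H₂ p = caseD h₀ H₁ H₂ := by
  have hall : ∀ x ∈ insert h₀ H₁ ∪ insert h₀ H₂, x < p := by
    intro x hx
    simp only [Finset.mem_union, Finset.mem_insert] at hx
    rcases hx with (rfl | hx) | (rfl | hx)
    · exact hh₀
    · exact hH₁ x hx
    · exact hh₀
    · exact hH₂ x hx
  -- reduction mod `p` is injective on `H₁⁰ ∪ H₂⁰`
  have hinj : Set.InjOn (fun h : ℕ => h % p) (↑(insert h₀ H₁ ∪ insert h₀ H₂) : Set ℕ) := by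
    intro a ha b hb h
    have h' : a % p = b % p := h
    rwa [Nat.mod_eq_of_lt (hall a ha), Nat.mod_eq_of_lt (hall b hb)] at h'
  rw [nuBarStar, nuBar_eq_card_inter, caseD]
  have himage : (insert h₀ H₁).image (fun h => h % p) ∩ (insert h₀ H₂).image (fun h => h % p) =
      (insert h₀ H₁ ∩ insert h₀ H₂).image (fun h => h % p) := by
    rw [Finset.image_inter_of_injOn (insert h₀ H₁) (insert h₀ H₂)
      (by rw [← Finset.coe_union]; exact hinj)]
  rw [himage, Finset.card_image_of_injOn (hinj.mono (by
      intro x hx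
      simp only [Finset.coe_inter, Set.mem_inter_iff, Finset.mem_coe] at hx
      simp only [Finset.coe_union, Set.mem_union, Finset.mem_coe]
      exact Or.inl hx.1))]
  have hins : insert h₀ H₁ ∩ insert h₀ H₂ = insert h₀ ((H₁ ∩ H₂).erase h₀) := by
    ext x; simp only [Finset.mem_inter, Finset.mem_insert, Finset.mem_erase]; tauto
  rw [hins, Finset.card_insert_of_notMem (Finset.notMem_erase h₀ _)]
  omega

/-! ### The Euler factor of (9.16) and its value at `(0, 0)` -/

/-- GPY (9.16): the Euler factor
`1 − ν*_p(H₁⁰)/((p−1)p^{s₁}) − ν*_p(H₂⁰)/((p−1)p^{s₂}) + ν̄*_p((H₁ ∩̄ H₂)⁰)/((p−1)p^{s₁+s₂})` of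
the double series `F(s₁, s₂)` of the main term `𝒯̃_R` (a factor `p − 1 = φ(p)` replaces the `p`
of (7.8)). [cite: GoldstonPintzYildirim2009, Section 9 eq. 9.16] -/
def starFactor (h₀ : ℕ) (H₁ H₂ : Finset ℕ) (p : ℕ) (s₁ s₂ : ℂ) : ℂ :=
  1 - (nuStarPrime h₀ H₁ p : ℂ) / (((p : ℂ) - 1) * (p : ℂ) ^ s₁)
    - (nuStarPrime h₀ H₂ p : ℂ) / (((p : ℂ) - 1) * (p : ℂ) ^ s₂)
    + (nuBarStar h₀ H₁ H₂ p : ℂ) / (((p : ℂ) - 1) * (p : ℂ) ^ (s₁ + s₂))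

/-- The generic Euler factor of (9.16), "for `p > h`":
`1 − a/((p−1)p^{s₁}) − b/((p−1)p^{s₂}) + d/((p−1)p^{s₁+s₂})` with `(a, b, d)` the case exponents
(Cases 1–3). [cite: GoldstonPintzYildirim2009, Section 9 eq. 9.17] -/
theorem starFactor_eq_of_lt {h₀ p : ℕ} {H₁ H₂ : Finset ℕ} (hh₀ : h₀ < p) (hH₁ : ∀ x ∈ H₁, x < p)
    (hH₂ : ∀ x ∈ H₂, x < p) (s₁ s₂ : ℂ) :
    starFactor h₀ H₁ H₂ p s₁ s₂ =
      1 - (caseA h₀ H₁ : ℂ) / (((p : ℂ) - 1) * (p : ℂ) ^ s₁)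
        - (caseA h₀ H₂ : ℂ) / (((p : ℂ) - 1) * (p : ℂ) ^ s₂)
        + (caseD h₀ H₁ H₂ : ℂ) / (((p : ℂ) - 1) * (p : ℂ) ^ (s₁ + s₂)) := by
  rw [starFactor, nuStarPrime_eq_caseA hh₀ hH₁, nuStarPrime_eq_caseA hh₀ hH₂,
    nuBarStar_eq_caseD hh₀ hH₁ hH₂]

/-- `ν*_p(H₁⁰) + ν*_p(H₂⁰) − ν̄*_p((H₁ ∩̄ H₂)⁰) = ν_p(H⁰) − 1`, `H⁰ = H₁ ∪ H₂ ∪ {h₀}` (as an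
additive identity in `ℕ`; `nuBarStar_eq`). [cite: GoldstonPintzYildirim2009, Section 9 eq. 9.21] -/
theorem nuStarPrime_add_eq (h₀ : ℕ) (H₁ H₂ : Finset ℕ) (p : ℕ) :
    nuStarPrime h₀ H₁ p + nuStarPrime h₀ H₂ p + 1 =
      nuPrime (insert h₀ (H₁ ∪ H₂)) p + nuBarStar h₀ H₁ H₂ p := by
  have h := nuBarStar_eq h₀ H₁ H₂ p
  have h1 := one_le_nuPrime_insert h₀ (H₁ ∪ H₂) p
  unfold nuStarPrime at h ⊢
  omega

/-- **(9.21), locally**: at `(0, 0)` the factor of (9.16) is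
`1 − (ν_p(H⁰) − 1)/(p − 1) = (p − ν_p(H⁰))/(p − 1)` (`p ≥ 2`).
[cite: GoldstonPintzYildirim2009, Section 9 eq. 9.21] -/
theorem starFactor_zero_zero (h₀ : ℕ) (H₁ H₂ : Finset ℕ) {p : ℕ} (hp : 2 ≤ p) :
    starFactor h₀ H₁ H₂ p 0 0 =
      ((p : ℂ) - nuPrime (insert h₀ (H₁ ∪ H₂)) p) / ((p : ℂ) - 1) := by
  have hp1 : ((p : ℂ) - 1) ≠ 0 := by
    have : (1 : ℝ) < p := by exact_mod_cast hp
    exact_mod_cast (sub_ne_zero.2 (by exact_mod_cast (ne_of_gt this) : (p : ℂ) ≠ 1))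
  have hid := nuStarPrime_add_eq h₀ H₁ H₂ p
  have hid' : (nuStarPrime h₀ H₁ p : ℂ) + nuStarPrime h₀ H₂ p + 1 =
      nuPrime (insert h₀ (H₁ ∪ H₂)) p + nuBarStar h₀ H₁ H₂ p := by exact_mod_cast hid
  rw [starFactor, add_zero, Complex.cpow_zero, mul_one]
  field_simp
  linear_combination -hid'

/-! ### The factors of `G` ((9.17)–(9.19)) and `G(0, 0) = 𝔖(H⁰)` ((9.20)–(9.23)) -/

/-- The Euler factor of `G(s₁, s₂) = F(s₁, s₂) ζ(1+s₁)^a ζ(1+s₂)^b ζ(1+s₁+s₂)^{−d}` ((9.17)–(9.19);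
for Proposition 2 `(a, b, d) = (caseA h₀ H₁, caseA h₀ H₂, caseD h₀ H₁ H₂)`):
`starFactor · (1 − p^{−1−s₁})^{−a} (1 − p^{−1−s₂})^{−b} (1 − p^{−1−s₁−s₂})^{d}`.
[cite: GoldstonPintzYildirim2009, Section 9 eq. 9.17] -/
def starGFactor (h₀ : ℕ) (H₁ H₂ : Finset ℕ) (a b d : ℕ) (p : ℕ) (s₁ s₂ : ℂ) : ℂ :=
  starFactor h₀ H₁ H₂ p s₁ s₂ * ((1 - (p : ℂ) ^ (-(1 + s₁)))⁻¹) ^ a *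
    ((1 - (p : ℂ) ^ (-(1 + s₂)))⁻¹) ^ b * (1 - (p : ℂ) ^ (-(1 + s₁ + s₂))) ^ d

/-- `G(s₁, s₂) = ∏_p starGFactor` ((9.17)–(9.19); unconditional product over the primes — its
convergence for `σ₁, σ₂ > −1/4` is the next step of the source).
[cite: GoldstonPintzYildirim2009, Section 9 eq. 9.17] -/
def GStar (h₀ : ℕ) (H₁ H₂ : Finset ℕ) (a b d : ℕ) (s₁ s₂ : ℂ) : ℂ :=
  ∏' p : Nat.Primes, starGFactor h₀ H₁ H₂ a b d p s₁ s₂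

/-- **(9.22)–(9.23), locally**: at `(0, 0)` and with the case exponents, the factor of `G` is the
Hardy–Littlewood factor of `H⁰ = H₁ ∪ H₂ ∪ {h₀}`:
`((p − ν_p(H⁰))/(p − 1)) (1 − 1/p)^{−(a+b−d)} = (1 − ν_p(H⁰)/p)(1 − 1/p)^{−#H⁰}` since
`a + b − d = #H⁰ − 1`. [cite: GoldstonPintzYildirim2009, Section 9 eq. 9.22] -/
theorem starGFactor_zero_zero (h₀ : ℕ) (H₁ H₂ : Finset ℕ) {p : ℕ} (hp : p.Prime) :
    starGFactor h₀ H₁ H₂ (caseA h₀ H₁) (caseA h₀ H₂) (caseD h₀ H₁ H₂) p 0 0 =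
      ((singularSeriesFactor ((insert h₀ (H₁ ∪ H₂)).image ((↑) : ℕ → ℤ)) p : ℝ) : ℂ) := by
  have hp2 := hp.two_le
  have hp0 : (p : ℂ) ≠ 0 := by exact_mod_cast hp.ne_zero
  have hp1 : ((p : ℂ) - 1) ≠ 0 := by
    have : (1 : ℝ) < p := by exact_mod_cast hp2
    exact_mod_cast (sub_ne_zero.2 (by exact_mod_cast (ne_of_gt this) : (p : ℂ) ≠ 1))
  set ν := nuPrime (insert h₀ (H₁ ∪ H₂)) p with hν
  have hexp := caseA_add_caseB_sub_caseD h₀ H₁ H₂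
  set a := caseA h₀ H₁
  set b := caseA h₀ H₂
  set d := caseD h₀ H₁ H₂
  set k := #(insert h₀ (H₁ ∪ H₂)) with hk
  rw [starGFactor, starFactor_zero_zero h₀ H₁ H₂ hp2, singularSeriesFactor,
    tupleResidueCount_image_cast hp, Finset.card_image_of_injective _ Nat.cast_injective,
    add_zero, add_zero, Complex.cpow_neg_one]
  push_cast
  rw [← hν, ← hk]
  -- `(p − ν)/(p − 1) · u^a · u^b · u⁻¹^d = (1 − ν/p) · u^k`, `u = (1 − p⁻¹)⁻¹`, `a + b + 1 = k + d`
  have hu : (1 - (p : ℂ)⁻¹) ≠ 0 := by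
    rw [sub_ne_zero, ne_comm, Ne, inv_eq_one]
    exact_mod_cast hp.one_lt.ne'
  set U : ℂ := (1 - (p : ℂ)⁻¹)⁻¹ with hU
  have hUV : U * (1 - (p : ℂ)⁻¹) = 1 := by rw [hU, inv_mul_cancel₀ hu]
  have hkey : U ^ a * U ^ b * (1 - (p : ℂ)⁻¹) ^ d = U ^ k * (1 - (p : ℂ)⁻¹) := by
    have h1 : U ^ a * U ^ b * U = U ^ k * U ^ d := by
      rw [← pow_add, ← pow_succ, ← pow_add, hexp]
    have hd : U ^ d * (1 - (p : ℂ)⁻¹) ^ d = 1 := by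
      rw [← mul_pow, hUV, one_pow]
    calc U ^ a * U ^ b * (1 - (p : ℂ)⁻¹) ^ d
        = U ^ a * U ^ b * (1 - (p : ℂ)⁻¹) ^ d * (U * (1 - (p : ℂ)⁻¹)) := by rw [hUV, mul_one]
      _ = (U ^ a * U ^ b * U) * ((1 - (p : ℂ)⁻¹) ^ d * (1 - (p : ℂ)⁻¹)) := by ring
      _ = (U ^ k * U ^ d) * ((1 - (p : ℂ)⁻¹) ^ d * (1 - (p : ℂ)⁻¹)) := by rw [h1]
      _ = U ^ k * (U ^ d * (1 - (p : ℂ)⁻¹) ^ d) * (1 - (p : ℂ)⁻¹) := by ring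
      _ = U ^ k * (1 - (p : ℂ)⁻¹) := by rw [hd, mul_one]
  have hW : ((p : ℂ) - ν) / ((p : ℂ) - 1) * (1 - (p : ℂ)⁻¹) = 1 - (ν : ℂ) / p := by
    field_simp
  rw [one_div]
  calc ((p : ℂ) - ν) / ((p : ℂ) - 1) * U ^ a * U ^ b * (1 - (p : ℂ)⁻¹) ^ d
      = ((p : ℂ) - ν) / ((p : ℂ) - 1) * (U ^ a * U ^ b * (1 - (p : ℂ)⁻¹) ^ d) := by ring
    _ = ((p : ℂ) - ν) / ((p : ℂ) - 1) * (U ^ k * (1 - (p : ℂ)⁻¹)) := by rw [hkey]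
    _ = (((p : ℂ) - ν) / ((p : ℂ) - 1) * (1 - (p : ℂ)⁻¹)) * U ^ k := by ring
    _ = (1 - (ν : ℂ) / p) * U ^ k := by rw [hW]

/-- **GPY (9.20)**: `G(0, 0) = 𝔖(H⁰)` in all three cases ((9.22) for `h₀ ∉ H`, where
`H⁰ = H ∪ {h₀}`; (9.23) for `h₀ ∈ H`, where `H⁰ = H`), for the product over the primes of
`starGFactor` at the case exponents; `𝔖` is the tree's Hardy–Littlewood singular series
(`hasProd_singularSeriesFactor_holds`). [cite: GoldstonPintzYildirim2009, Section 9 eq. 9.20] -/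
theorem GStar_zero_zero (h₀ : ℕ) (H₁ H₂ : Finset ℕ) :
    GStar h₀ H₁ H₂ (caseA h₀ H₁) (caseA h₀ H₂) (caseD h₀ H₁ H₂) 0 0 =
      (singularSeriesNat (insert h₀ (H₁ ∪ H₂)) : ℂ) := by
  have h := (hasProd_singularSeriesFactor_holds ((insert h₀ (H₁ ∪ H₂)).image ((↑) : ℕ → ℤ))).map
    Complex.ofRealHom Complex.continuous_ofReal
  have heq : (fun p : Nat.Primes =>
      starGFactor h₀ H₁ H₂ (caseA h₀ H₁) (caseA h₀ H₂) (caseD h₀ H₁ H₂) p 0 0) =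
      ⇑Complex.ofRealHom ∘ fun p : Nat.Primes =>
        singularSeriesFactor ((insert h₀ (H₁ ∪ H₂)).image ((↑) : ℕ → ℤ)) p :=
    funext fun p => starGFactor_zero_zero h₀ H₁ H₂ p.2
  rw [GStar, heq, h.tprod_eq, singularSeriesNat]
  rfl

/-- Cases 2–3: for `h₀ ∈ H = H₁ ∪ H₂`, `H⁰ = H`, so `G(0,0) = 𝔖(H)` ((9.23)).
[cite: GoldstonPintzYildirim2009, Section 9 eq. 9.23] -/
theorem GStar_zero_zero_of_mem {h₀ : ℕ} {H₁ H₂ : Finset ℕ} (h : h₀ ∈ H₁ ∪ H₂) :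
    GStar h₀ H₁ H₂ (caseA h₀ H₁) (caseA h₀ H₂) (caseD h₀ H₁ H₂) 0 0 =
      (singularSeriesNat (H₁ ∪ H₂) : ℂ) := by
  rw [GStar_zero_zero, Finset.insert_eq_of_mem h]

end Literature.NumberTheory.Sieve.GPY
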